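import Mathlib
import Literature.MathematicalPhysics.StatisticalMechanics.BarlowStacking
import Literature.MathematicalPhysics.StatisticalMechanics.LennardJonesClusters
import HarnessLib

/-!
# Transfer bookkeeping for matched windows of Barlow stackings

Generic lemmas (independent of the Hägg word and of the pair potential) behind the comparison of a
pair functional of a finite configuration `x : Fin N → ℝ³`, matched near a reference point set
`S`, with the same functional of an enumerated finite window `P : Fin N' → S` (the "perturbative
transfer" step of restacking competitors; route `SquareWellLayerCake`, crux `StackingFaultSparsity`,
stmt-AtomisticToContinuum-14296).  All statements are folklore.

* §1 Pair sums: `∑_i ∑_j F i j = 2 ∑_{i<j} F i j` for a symmetric `F` vanishing on the diagonal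
  (`sum_sum_eq_two_mul_sum_Ioi`), and the transport of a full double sum along an embedding
  `φ : Fin N' ↪ Fin N` for an `F` vanishing off the image (`sum_sum_eq_of_embedding`);
  row-weighted symmetric double sums (`sum_sum_add_mul_of_symm`) and the shell sum
  `∑_m' |y m - y m'|⁻⁶ ≤ 250 r⁻⁶` over a whole `r`-separated configuration
  (`sum_univ_inv_pow_six_le`, from `sum_inv_pow_six_le`).
* §2 Matchings (any metric space): if `x` is `d₀`-separated, `S` is `δ₀`-separated,
  `2ε < min d₀ δ₀`, every point of `S` within `L` of `z` is imaged by an isometry `g` (`g z = x i`)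
  within `ε` of a particle, every particle within `L` of `x i` is within `ε` of an imaged point of
  `S`, and `P` enumerates `S ∩ B(b, R)` with `dist b z + R + 1 ≤ L`, then the matching
  `m ↦ (the particle near g (P m))` is an embedding `φ : Fin N' ↪ Fin N`, particles near imaged
  points of `S ∩ B(b, R)` are in its range, and a particle NOT in its range is at distance
  `≥ R - dist (P m) b - 2ε` from `x (φ m)` (`exists_matching_embedding`).
* §3 Cylinders: the stacking indices `(n, i', j')`, `q₁ < n < q₂`, whose points lie laterally within
  `ρ` of a fixed point number at most `(q₂ - q₁) (8ρ/a + 1)²` (`card_le_of_lateral_sq_le`).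
-/

noncomputable section

open scoped BigOperators

namespace Literature.MathematicalPhysics.StatisticalMechanics

/-! ## 1. Pair sums -/

/-- A symmetric array vanishing on the diagonal: the full double sum is twice the sum over
`i < j`. [folklore] -/
theorem sum_sum_eq_two_mul_sum_Ioi {N : ℕ} (F : Fin N → Fin N → ℝ) (hs : ∀ i j, F i j = F j i)
    (hd : ∀ i, F i i = 0) :
    ∑ i, ∑ j, F i j = 2 * ∑ i, ∑ j ∈ Finset.Ioi i, F i j := by
  -- adapted from `two_mul_interactionEnergy` (LennardJonesClusters)
  have hsplit : ∀ i : Fin N, Finset.univ.erase i = Finset.Ioi i ∪ Finset.Iio i := fun i => by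
    ext k
    simp only [Finset.mem_erase, Finset.mem_univ, and_true, Finset.mem_union, Finset.mem_Ioi,
      Finset.mem_Iio]
    exact ne_iff_lt_or_gt.trans or_comm
  have hdisj : ∀ i : Fin N, Disjoint (Finset.Ioi i) (Finset.Iio i) := fun i =>
    Finset.disjoint_left.2 fun k hk hk' => lt_asymm (Finset.mem_Ioi.1 hk) (Finset.mem_Iio.1 hk')
  have h1 : ∀ i : Fin N, ∑ j, F i j = ∑ j ∈ Finset.Ioi i, F i j + ∑ j ∈ Finset.Iio i, F i j := by
    intro i
    rw [← Finset.add_sum_erase _ _ (Finset.mem_univ i), hd, zero_add, hsplit i,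
      Finset.sum_union (hdisj i)]
  have h2 : ∑ i, ∑ j ∈ Finset.Iio i, F i j = ∑ i, ∑ j ∈ Finset.Ioi i, F i j := by
    rw [Finset.sum_comm' (t' := Finset.univ) (s' := fun k => Finset.Ioi k)]
    · exact Finset.sum_congr rfl fun k _ => Finset.sum_congr rfl fun i _ => hs _ _
    · intro i k
      simp
  simp only [h1, Finset.sum_add_distrib, h2]
  ring

/-- Transport of a full double sum along an embedding `φ : Fin N' ↪ Fin N`: if the symmetric
array `F` vanishes when both indices are off the image of `φ`, then
`∑_j ∑_j' F j j' = ∑_m ∑_m' F (φ m) (φ m') + 2 ∑_m ∑_{j' ∉ im φ} F (φ m) j'`. [folklore] -/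
theorem sum_sum_eq_of_embedding {N N' : ℕ} (F : Fin N → Fin N → ℝ) (hs : ∀ i j, F i j = F j i)
    (φ : Fin N' ↪ Fin N)
    (h0 : ∀ j j', j ∉ Finset.univ.map φ → j' ∉ Finset.univ.map φ → F j j' = 0) :
    ∑ j, ∑ j', F j j' = ∑ m, ∑ m', F (φ m) (φ m') +
      2 * ∑ m, ∑ j' ∈ (Finset.univ.map φ)ᶜ, F (φ m) j' := by
  classical
  set W : Finset (Fin N) := Finset.univ.map φ with hW
  rw [sum_sum_eq_add_compl F W]
  have hA : ∑ j ∈ W, ∑ j' ∈ W, F j j' = ∑ m, ∑ m', F (φ m) (φ m') := by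
    rw [hW, Finset.sum_map]
    exact Finset.sum_congr rfl fun m _ => Finset.sum_map _ _ _
  have hB : ∑ j ∈ Wᶜ, ∑ j' ∈ Wᶜ, F j j' = 0 :=
    Finset.sum_eq_zero fun j hj => Finset.sum_eq_zero fun j' hj' =>
      h0 j j' (Finset.mem_compl.1 hj) (Finset.mem_compl.1 hj')
  have hC : ∑ j ∈ Wᶜ, ∑ j' ∈ W, F j j' = ∑ j ∈ W, ∑ j' ∈ Wᶜ, F j j' := by
    rw [Finset.sum_comm]
    exact Finset.sum_congr rfl fun j _ => Finset.sum_congr rfl fun j' _ => hs _ _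
  have hD : ∑ j ∈ W, ∑ j' ∈ Wᶜ, F j j' = ∑ m, ∑ j' ∈ Wᶜ, F (φ m) j' := by
    rw [hW, Finset.sum_map]
  rw [hA, hB, hC, hD]
  ring

/-- Row-weighted symmetric double sums: `∑_m ∑_m' (c m + c m') B m m' = 2 ∑_m c m ∑_m' B m m'` for a
symmetric array `B`. [folklore] -/
theorem sum_sum_add_mul_of_symm {ι : Type*} [Fintype ι] (B : ι → ι → ℝ)
    (hB : ∀ m m', B m m' = B m' m) (c : ι → ℝ) :
    ∑ m, ∑ m', (c m + c m') * B m m' = 2 * ∑ m, c m * ∑ m', B m m' := by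
  have h1 : ∑ m, ∑ m', c m' * B m m' = ∑ m, ∑ m', c m * B m m' := by
    rw [Finset.sum_comm]
    exact Finset.sum_congr rfl fun m _ => Finset.sum_congr rfl fun m' _ => by rw [hB]
  rw [Finset.mul_sum]
  simp only [add_mul, Finset.sum_add_distrib, h1, Finset.mul_sum]
  rw [← Finset.sum_add_distrib]
  exact Finset.sum_congr rfl fun m _ => by rw [← Finset.sum_add_distrib]; ring

/-- The shell sum over a whole separated configuration of `ℝ³`, diagonal included (it vanishes by
`0⁻¹ = 0`): `∑_m' |y m - y m'|⁻⁶ ≤ 250 r⁻⁶`. [folklore] -/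
theorem sum_univ_inv_pow_six_le {M : ℕ} (y : Fin M → EuclideanSpace ℝ (Fin 3)) {r : ℝ}
    (hr : 0 < r) (hsep : ∀ k l, k ≠ l → r ≤ dist (y k) (y l)) (m : Fin M) :
    ∑ m', (dist (y m) (y m'))⁻¹ ^ 6 ≤ 250 * r⁻¹ ^ 6 := by
  rw [← Finset.add_sum_erase _ _ (Finset.mem_univ m), dist_self, inv_zero, zero_pow (by norm_num),
    zero_add]
  exact sum_inv_pow_six_le y hr hsep m

/-! ## 2. Matchings of separated configurations to enumerated reference windows -/

/-- Two points within `ε` of two centres have their distance within `2ε` of the distance of the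
centres. [folklore] -/
theorem abs_dist_sub_dist_le_two_mul {X : Type*} [PseudoMetricSpace X] {y₁ y₂ c₁ c₂ : X} {ε : ℝ}
    (h₁ : dist y₁ c₁ ≤ ε) (h₂ : dist y₂ c₂ ≤ ε) : |dist y₁ y₂ - dist c₁ c₂| ≤ 2 * ε := by
  have h := dist_dist_dist_le y₁ y₂ c₁ c₂
  rw [Real.dist_eq] at h
  linarith

/-- A point within `ε` of the images (under an isometry `g`) of two points of a `δ₀`-separated
set, `2ε < δ₀`, sees the same point twice. [folklore] -/
theorem eq_of_dist_image_le {X : Type*} [MetricSpace X] {S : Set X} {g : X → X} {δ₀ ε : ℝ}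
    (hg : ∀ p q, dist (g p) (g q) = dist p q) (hS : ∀ p ∈ S, ∀ q ∈ S, p ≠ q → δ₀ ≤ dist p q)
    (hεδ : 2 * ε < δ₀) {y p q : X} (hp : p ∈ S) (hq : q ∈ S) (hyp : dist y (g p) ≤ ε)
    (hyq : dist y (g q) ≤ ε) : p = q := by
  by_contra hne
  have h := hS p hp q hq hne
  rw [← hg] at h
  linarith [dist_triangle_left (g p) (g q) y]

/-- **The matching embedding.**  Let `x : Fin N → X` be `d₀`-separated and `S ⊆ X`
`δ₀`-separated, `0 ≤ ε`, `2ε < d₀`, `2ε < δ₀`; let `g` be an isometry with `g z = x i` such that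
every point of `S` within `L` of `z` has a particle within `ε` of its image and every particle
within `L` of `x i` is within `ε` of the image of a point of `S`; let `P : Fin N' → X` enumerate
injectively `S ∩ B(b, R)`, `dist b z + R + 1 ≤ L`.  Then there is an embedding `φ : Fin N' ↪ Fin N`
with `x (φ m)` within `ε` of `g (P m)`; it is the only such particle; every particle within `ε` of
the image of a point of `S ∩ B(b, R)` is in the range of `φ`; and a particle off the range of `φ`
is at distance `≥ R - dist (P m) b - 2ε` from `x (φ m)`. [folklore] -/
theorem exists_matching_embedding {X : Type*} [MetricSpace X] {N N' : ℕ} {x : Fin N → X}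
    {i : Fin N} {S : Set X} {g : X → X} {z b : X} {d₀ δ₀ ε L R : ℝ} {P : Fin N' → X}
    (hg : ∀ p q, dist (g p) (g q) = dist p q) (hgz : g z = x i)
    (hsep : ∀ j j', j ≠ j' → d₀ ≤ dist (x j) (x j'))
    (hS : ∀ p ∈ S, ∀ q ∈ S, p ≠ q → δ₀ ≤ dist p q) (hε : 0 ≤ ε) (hεd : 2 * ε < d₀)
    (hεδ : 2 * ε < δ₀) (h1 : ∀ p ∈ S, dist p z ≤ L → ∃ j, dist (x j) (g p) ≤ ε)
    (h2 : ∀ j, dist (x j) (x i) ≤ L → ∃ p ∈ S, dist (x j) (g p) ≤ ε)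
    (hPinj : Function.Injective P) (hPr : Set.range P = {p ∈ S | dist p b ≤ R})
    (hL : dist b z + R + 1 ≤ L) :
    ∃ φ : Fin N' ↪ Fin N,
      (∀ m, dist (x (φ m)) (g (P m)) ≤ ε) ∧
      (∀ j m, dist (x j) (g (P m)) ≤ ε → j = φ m) ∧
      (∀ j, ∀ p ∈ S, dist (x j) (g p) ≤ ε → dist p b ≤ R → j ∈ Set.range φ) ∧
      (∀ m j, j ∉ Set.range φ → R - dist (P m) b - 2 * ε ≤ dist (x (φ m)) (x j)) := by
  have hPm : ∀ m, P m ∈ S ∧ dist (P m) b ≤ R := fun m =>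
    (Set.ext_iff.1 hPr (P m)).1 ⟨m, rfl⟩
  have hPz : ∀ m, dist (P m) z ≤ L := fun m => by
    linarith [dist_triangle (P m) b z, (hPm m).2]
  -- uniqueness of the particle near a point, and of the point near a particle
  have hU2 : ∀ (j j' : Fin N) (q : X), dist (x j) q ≤ ε → dist (x j') q ≤ ε → j = j' := by
    intro j j' q hj hj'
    by_contra hne
    have h := hsep j j' hne
    linarith [dist_triangle_right (x j) (x j') q]
  choose φ₀ hφ₀ using fun m => h1 (P m) (hPm m).1 (hPz m)
  have hinj : Function.Injective φ₀ := by
    intro m m' hmm'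
    have h := hφ₀ m'
    rw [← hmm'] at h
    exact hPinj (eq_of_dist_image_le hg hS hεδ (hPm m).1 (hPm m').1 (hφ₀ m) h)
  refine ⟨⟨φ₀, hinj⟩, hφ₀, fun j m hj => hU2 _ _ _ hj (hφ₀ m), ?_, ?_⟩
  · intro j p hp hjp hpb
    obtain ⟨m, rfl⟩ : p ∈ Set.range P := by rw [hPr]; exact ⟨hp, hpb⟩
    exact ⟨m, (hU2 _ _ _ hjp (hφ₀ m)).symm⟩
  · intro m j hj
    have hm := hφ₀ m
    change R - dist (P m) b - 2 * ε ≤ dist (x (φ₀ m)) (x j)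
    by_cases hjL : dist (x j) (x i) ≤ L
    · obtain ⟨p, hp, hjp⟩ := h2 j hjL
      have hpb : R < dist p b := by
        by_contra hle
        refine hj ?_
        obtain ⟨m', rfl⟩ : p ∈ Set.range P := by rw [hPr]; exact ⟨hp, not_lt.1 hle⟩
        exact ⟨m', (hU2 _ _ _ hjp (hφ₀ m')).symm⟩
      have e1 := dist_triangle p (P m) b
      have e2 := abs_dist_sub_dist_le_two_mul hm hjp
      rw [hg, abs_le] at e2
      rw [dist_comm p (P m)] at e1
      linarith [e2.1]
    · push Not at hjL
      have e1 : dist (x (φ₀ m)) (x i) ≤ ε + dist (P m) z := by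
        have := dist_triangle (x (φ₀ m)) (g (P m)) (x i)
        rw [← hgz, hg] at this
        rw [← hgz]
        linarith
      have e2 := dist_triangle (P m) b z
      have e3 := dist_triangle_left (x j) (x i) (x (φ₀ m))
      linarith

/-! ## 3. Cylinders -/

/-- **Lattice points of a cylinder.**  The stacking indices `(n, i', j')` with `q₁ < n < q₂` whose
points lie laterally (first two coordinates) within `ρ` of the point `barlowPos q₁ i₀ j₀` number at
most `(q₂ - q₁) (8ρ/a + 1)²`: `(n, 2i' + j' + L n, 3j' + L n)` injects them into a box.
[folklore] -/
theorem card_le_of_lateral_sq_le {a h ρ : ℝ} (ha : 0 < a) (hρ : 0 ≤ ρ) (s : ℤ → ℤ) {q₁ q₂ : ℤ}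
    (hq : q₁ ≤ q₂) (i₀ j₀ : ℤ) (T : Finset (ℤ × ℤ × ℤ))
    (hT : ∀ t ∈ T, q₁ < t.1 ∧ t.1 < q₂ ∧
      (barlowPos a h s t.1 t.2.1 t.2.2 0 - barlowPos a h s q₁ i₀ j₀ 0) ^ 2 +
        (barlowPos a h s t.1 t.2.1 t.2.2 1 - barlowPos a h s q₁ i₀ j₀ 1) ^ 2 ≤ ρ ^ 2) :
    (T.card : ℝ) ≤ ((q₂ : ℝ) - q₁) * (8 * ρ / a + 1) ^ 2 := by
  classical
  have h3 : (√3 : ℝ) ^ 2 = 3 := Real.sq_sqrt (by norm_num)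
  set D : ℕ := ⌊4 * ρ / a⌋₊ with hD
  have hD0 : (0 : ℝ) ≤ 4 * ρ / a := by positivity
  set X₀ : ℤ := 2 * i₀ + j₀ + haggLabel s q₁ with hX₀
  set Y₀ : ℤ := 3 * j₀ + haggLabel s q₁ with hY₀
  set f : ℤ × ℤ × ℤ → ℤ × ℤ × ℤ := fun t =>
    (t.1, 2 * t.2.1 + t.2.2 + haggLabel s t.1, 3 * t.2.2 + haggLabel s t.1) with hf
  set B : Finset (ℤ × ℤ × ℤ) := Finset.Ioo q₁ q₂ ×ˢ
    (Finset.Icc (X₀ - D) (X₀ + D) ×ˢ Finset.Icc (Y₀ - D) (Y₀ + D)) with hB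
  -- an integer of real size `≤ 4ρ/a` has `natAbs ≤ D`
  have hround : ∀ u : ℤ, |(u : ℝ)| ≤ 4 * ρ / a → u.natAbs ≤ D := by
    intro u hu
    refine Nat.le_floor ?_
    rw [Nat.cast_natAbs, Int.cast_abs]
    exact hu
  have hmaps : ∀ t ∈ T, f t ∈ B := by
    intro t ht
    obtain ⟨hn1, hn2, hlat⟩ := hT t ht
    have e0 : barlowPos a h s t.1 t.2.1 t.2.2 0 - barlowPos a h s q₁ i₀ j₀ 0 =
        a / 2 * (((2 * t.2.1 + t.2.2 + haggLabel s t.1 - X₀ : ℤ) : ℝ)) := by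
      rw [barlowPos_apply_zero, barlowPos_apply_zero, hX₀]
      push_cast
      ring
    have e1 : barlowPos a h s t.1 t.2.1 t.2.2 1 - barlowPos a h s q₁ i₀ j₀ 1 =
        a * √3 / 6 * (((3 * t.2.2 + haggLabel s t.1 - Y₀ : ℤ) : ℝ)) := by
      rw [barlowPos_apply_one, barlowPos_apply_one, hY₀]
      push_cast
      ring
    rw [e0, e1] at hlat
    set u : ℤ := 2 * t.2.1 + t.2.2 + haggLabel s t.1 - X₀ with hu
    set v : ℤ := 3 * t.2.2 + haggLabel s t.1 - Y₀ with hv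
    have hu1 : |(u : ℝ)| ≤ 4 * ρ / a := by
      have h1 : (a / 2 * (u : ℝ)) ^ 2 ≤ ρ ^ 2 := by nlinarith [sq_nonneg (a * √3 / 6 * (v : ℝ))]
      have h2 : |a / 2 * (u : ℝ)| ≤ ρ := abs_le_of_sq_le_sq' h1 hρ |>.2 |> fun h => by
        rw [abs_le]; exact ⟨(abs_le_of_sq_le_sq' h1 hρ).1, h⟩
      rw [abs_mul, abs_of_pos (by positivity : (0 : ℝ) < a / 2)] at h2
      rw [le_div_iff₀ ha]
      nlinarith [abs_nonneg (u : ℝ)]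
    have hv1 : |(v : ℝ)| ≤ 4 * ρ / a := by
      have h1 : (a * √3 / 6 * (v : ℝ)) ^ 2 ≤ ρ ^ 2 := by nlinarith [sq_nonneg (a / 2 * (u : ℝ))]
      have h1' : (a * |(v : ℝ)|) ^ 2 ≤ (4 * ρ) ^ 2 := by
        have : (a * √3 / 6 * (v : ℝ)) ^ 2 = a ^ 2 * (v : ℝ) ^ 2 / 12 := by
          rw [mul_pow, div_pow, mul_pow, h3]; ring
        rw [this] at h1
        rw [mul_pow, sq_abs]
        nlinarith [sq_nonneg (v : ℝ), sq_nonneg a]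
      have h2 : a * |(v : ℝ)| ≤ 4 * ρ := by
        nlinarith [abs_nonneg (v : ℝ), pow_le_pow_left₀ (by positivity : 0 ≤ a * |(v:ℝ)|) le_rfl 2]
      rw [le_div_iff₀ ha]
      linarith
    have hu2 := hround u hu1
    have hv2 := hround v hv1
    simp only [hB, hf, Finset.mem_product, Finset.mem_Ioo, Finset.mem_Icc]
    refine ⟨⟨hn1, hn2⟩, ⟨?_, ?_⟩, ⟨?_, ?_⟩⟩ <;> omega
  have hinj : Set.InjOn f T := by
    intro t _ t' _ htt'
    simp only [hf, Prod.mk.injEq] at htt'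
    obtain ⟨h1, h2, h3'⟩ := htt'
    have e3 : t.2.2 = t'.2.2 := by rw [h1] at h3'; omega
    have e2 : t.2.1 = t'.2.1 := by rw [h1, e3] at h2; omega
    exact Prod.ext h1 (Prod.ext e2 e3)
  have hcard := Finset.card_le_card_of_injOn f hmaps hinj
  have hBcard : B.card = (q₂ - q₁ - 1).toNat * ((2 * D + 1) * (2 * D + 1)) := by
    rw [hB, Finset.card_product, Finset.card_product, Int.card_Ioo, Int.card_Icc, Int.card_Icc]
    congr 2 <;> omega
  rw [hBcard] at hcard
  have h1 : ((q₂ - q₁ - 1).toNat : ℝ) ≤ (q₂ : ℝ) - q₁ := by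
    have : ((q₂ - q₁ - 1).toNat : ℤ) ≤ q₂ - q₁ := by omega
    exact_mod_cast this
  have h2 : ((2 * D + 1 : ℕ) : ℝ) ≤ 8 * ρ / a + 1 := by
    have hDle : (D : ℝ) ≤ 4 * ρ / a := Nat.floor_le hD0
    have e8 : 8 * ρ / a = 2 * (4 * ρ / a) := by ring
    push_cast
    linarith
  have hq' : (0 : ℝ) ≤ (q₂ : ℝ) - q₁ := by
    have : (q₁ : ℝ) ≤ q₂ := by exact_mod_cast hq
    linarith
  calc (T.card : ℝ) ≤ (((q₂ - q₁ - 1).toNat * ((2 * D + 1) * (2 * D + 1)) : ℕ) : ℝ) := by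
        exact_mod_cast hcard
    _ = ((q₂ - q₁ - 1).toNat : ℝ) * (((2 * D + 1 : ℕ) : ℝ) * ((2 * D + 1 : ℕ) : ℝ)) := by
        push_cast; ring
    _ ≤ ((q₂ : ℝ) - q₁) * ((8 * ρ / a + 1) * (8 * ρ / a + 1)) := by
        gcongr
    _ = ((q₂ : ℝ) - q₁) * (8 * ρ / a + 1) ^ 2 := by ring

end Literature.MathematicalPhysics.StatisticalMechanics

end
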